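import Summits.ABC.IUTFork.Thm311RealInd1StripTwistMoverOdd
import Summits.ABC.IUTFork.Thm311RealInd1StripTwistMoverJWUnits
import HarnessLib

/-!
# [IUTchIII] Thm 3.11 (i) (Ind1) at `v ∈ 𝕍^non`: print's strip part MOVES a closed ball at every `v ∣ p` odd with `f(v|p)` ODD
# and `e(v|p) ≥ 3` — modulo the Jannsen–Wingberg fact for ALL planes

PROOF-ONLY file (abc-iut cell, Cor. 3.12 sub-crew, seat abc-iut-c312-1 = holder of record of the typed [IUTchIII] Thm. 3.11,
gen 10; row «R11 IND1-STRIP-MOVER-ALL-PLANES»).  TAKES NO SIDE on [IUTchIII] Cor. 3.12.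

Gen 9's statements of record (`Thm311RealInd1StripTwistMoverJWUnits`, p472504; `…JWAll`, p474633) answer the R9f open point
(«does THE units transport of an arbitrary `φ ∈ Aut_top(G_v)` preserve `μ·U_v^(m)`?») NEGATIVELY at the places `v ∣ p` odd with
`f(v|p) = 1`, `e(v|p) ≥ 3`, using ONE Jannsen–Wingberg twist plane.  This file removes the restriction `f(v|p) = 1` in favour
of `f(v|p)` ODD, using ALL the twist planes of the master named fact `DehnTwistTransvectionsOnUnitsAll` (K. Kondo,
arXiv:2512.09231 §2, proof of Thm. 2.3 p. 10; Jannsen–Wingberg = NSW Thm. 7.5.14; Hoshi–Nishio 2022 Lemma 1.3: ONE `ℚ_p`-basis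
`y` of `k_+` indexed by `Fin c ⊕ Fin g × Fin 2`, `c ≤ 2`, every plane `(y_{(i,0)}, y_{(i,1)})` carrying both realised transvections)
and the all-planes parity obstruction `Thm311RealInd1StripTwistMoverOdd` (`[K_v : ℚ_p] = c + 2g < 3 + 2g ≤ e(v|p) + 2g`):

* **`Real.exists_mem_ind1StripOf_galoisLog_image_closedBall_ne_of_dehnTwistsAll_odd`** — ASSUMING
  `DehnTwistTransvectionsOnUnitsAll`: at every finite place `v ∣ p` of a number field `F` with `p` odd, `f(v|p)` odd and
  `e(v|p) ≥ 3`, some `χ ∈ Real.ind1StripOf v (Real.galoisLog v)` (print's (Ind1) strip part at `v`, through THE equivariant lift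
  and the Galois `p`-adic logarithm) and some `m ∈ ℤ` have `χ(B(0,‖ϖ‖^m)) ≠ B(0,‖ϖ‖^m)`;
* `…_analyticLogv_…` — the same over abc-iut-c312-5's `analyticLogv F v` (w5-d216 `galoisLog_eq_analyticLogv`).

Relevance (neutral): at `v ∈ 𝕍^bad` of an initial Θ-datum, `K_v ⊇ ℚ_p(ζ_l, q_v^{1/l})`, so `f(v|p)` is a multiple of
`ord_l(p)` — `f(v|p) = 1` needs `p ≡ 1 (mod l)`, whereas «`f(v|p)` odd» holds e.g. whenever `ord_l(p)` and `f(F_v|ℚ_p)` are odd.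
HONEST SCOPE: conditional on a named classical fact (binder `hJW`); a statement about OUR typed objects at ONE place; nothing here
asserts or refutes [IUTchIII] Cor. 3.12.  [claim: Mochizuki2012, status: disputed]; [cite: Kondo2025OuterAutMLF, §2 Thm 2.1 and
proof of Thm 2.3 p.10]; [cite: NeukirchSchmidtWingberg2008, Thm 7.5.14]; [cite: DupuyHilado2025, §4.7].  typed ≠ proved; a
conditional theorem discharges nothing it binds.
-/

set_option autoImplicit false

noncomputable section

open Metric Set
open scoped Pointwise

namespace Summit.ABC.IUTFork.Thm311.Real

open NumberField IsDedekindDomain Literature.NumberTheory.NumberFields Literature.IUT.LogVolume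
open Literature.NumberTheory.GaloisRepresentations Literature.NumberTheory.GaloisRepresentations.Ultrametric
open Literature.AnabelianGeometry.AbsoluteAnabelian Literature.IUT.HodgeArakelov
open Literature.IUT.HodgeArakelov.AbsTopMonoids

variable {F : Type} [Field F] [NumberField F] (v : HeightOneSpectrum (𝓞 F))

/-- **PRINT'S (Ind1) STRIP PART MOVES A BALL at every `v ∣ p` with `p` odd, `f(v|p)` ODD, `e(v|p) ≥ 3` — modulo the
Jannsen–Wingberg twist fact for ALL planes.**  Assume `DehnTwistTransvectionsOnUnitsAll` (Kondo arXiv:2512.09231 §2 / NSW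
Thm. 7.5.14, unit-restricted, every plane of one basis `Fin c ⊕ Fin g × Fin 2`, `c ≤ 2`).  Let `v` be a finite place of the
number field `F` over the odd prime `p` with `f(v|p)` odd and `e(v|p) ≥ 3`, `K_v` read in abc-iut-S7's rescaled norm, `ϖ` a
uniformizer.  Then there are `χ ∈ Real.ind1StripOf v (Real.galoisLog v)` and `m ∈ ℤ` with `χ(B(0,‖ϖ‖^m)) ≠ B(0,‖ϖ‖^m)`.
(The `g` twist planes give `2g` realised transvections — `realises_galoisLog_of_liftActsOnUnitLogAs` —, continuous as linear
maps of the finite-dimensional `ℚ_p`-space `K_v`; `[K_v : ℚ_p] = c + 2g < e(v|p) + 2g`; then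
`exists_mem_ind1StripOf_image_closedBall_ne_of_planes`.)  Supersedes the `f(v|p) = 1` statements of record of gen 9 in range.
[claim: Mochizuki2012, status: disputed] [cite: Kondo2025OuterAutMLF, §2 Thm 2.1 and proof of Thm 2.3 p.10]
[cite: DupuyHilado2025, §4.7] -/
theorem exists_mem_ind1StripOf_galoisLog_image_closedBall_ne_of_dehnTwistsAll_odd (hJW : DehnTwistTransvectionsOnUnitsAll)
    (p : ℕ) [Fact p.Prime] (hv : ((p : ℕ) : 𝓞 F) ∈ v.asIdeal) (hp2 : p ≠ 2)
    (hf : Odd (v.asIdeal.inertiaDeg ℤ)) (he : 3 ≤ v.asIdeal.ramificationIdx ℤ)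
    {ϖ : (RescaledCompletion F p v hv)ˣ} (hϖ : IsUniformizer ϖ) :
    ∃ χ ∈ ind1StripOf v (galoisLog v), ∃ m : ℤ,
      (fun x => RescaledCompletion.of F p v hv (χ ((RescaledCompletion.of F p v hv).symm x))) ''
          closedBall (0 : RescaledCompletion F p v hv) (‖(ϖ : RescaledCompletion F p v hv)‖ ^ m) ≠
        closedBall (0 : RescaledCompletion F p v hv) (‖(ϖ : RescaledCompletion F p v hv)‖ ^ m) := by
  -- `p` IS the residue characteristic of `K_v`
  obtain rfl : p = (closureAt v).residueChar := eq_residueChar_closureAt_of_natCast_mem v hv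
  have hpk : ValuativeRel.valuation (v.adicCompletion F) (closureAt v).residueChar < 1 :=
    LocalField.valuation_adicCompletion_natCast_lt_one v (closureAt v).residueChar hv
  -- the canonical `ℚ_p`-structure of `K_v` (the fact's `LocalField.padicAlgebra`; = abc-iut-S7's on the rescaled completion)
  haveI : CharZero (closureAt v).k := (closureAt v).instChar
  letI iQ : Algebra ℚ_[(closureAt v).residueChar] (closureAt v).k :=
    LocalField.padicAlgebra (closureAt v).k (closureAt v).residueChar hpk
  -- `[K_v : ℚ_p] = e·f ≥ e ≥ 3`
  have hlocal : localDeg F v = Module.finrank ℚ_[(closureAt v).residueChar] (closureAt v).k := by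
    exact RescaledCompletion.localDeg_eq_finrank F (closureAt v).residueChar v hv
  have hfin : 3 ≤ Module.finrank ℚ_[(closureAt v).residueChar] (closureAt v).k := by
    rw [← hlocal, localDeg]
    exact he.trans (Nat.le_mul_of_pos_right _ hf.pos)
  -- the twists: ONE basis `y : Fin c ⊕ Fin g × Fin 2`, `c ≤ 2`, all `g` planes realised
  obtain ⟨c, g, hc, y, hplanes⟩ := hJW (closureAt v) (closureAt v).residueChar hpk hp2 hfin
  have h1 := fun i => (hplanes i).1
  have h2 := fun i => (hplanes i).2
  choose φ hφ using h1
  choose φ' hφ' using h2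
  -- `[K_v : ℚ_p] = c + 2g < e + 2g`
  have hdim : localDeg F v < v.asIdeal.ramificationIdx ℤ + 2 * Fintype.card (Fin g) := by
    rw [hlocal, Module.finrank_eq_card_basis y, Fintype.card_sum, Fintype.card_prod, Fintype.card_fin, Fintype.card_fin,
      Fintype.card_fin]
    omega
  -- the module topology of `K_v` over `ℚ_p`: linear maps are continuous
  haveI : ContinuousSMul ℚ_[(closureAt v).residueChar] (closureAt v).k :=
    continuousSMul_of_algebraMap ℚ_[(closureAt v).residueChar] _
      (by exact LocalField.continuous_algebraMap_adicCompletionPadicAlgebra v (closureAt v).residueChar hv)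
  haveI : FiniteDimensional ℚ_[(closureAt v).residueChar] (closureAt v).k :=
    Module.finite_of_finrank_pos (by omega)
  -- Kronecker dualities of the basis coordinates
  have hcoord : ∀ s t : Fin c ⊕ Fin g × Fin 2, y.coord s (y t) = if t = s then 1 else 0 := by
    intro s t
    rw [Module.Basis.coord_apply, Module.Basis.repr_self, Finsupp.single_apply]
  have haa : ∀ i j : Fin g, y.coord (Sum.inr (i, 0)) (y (Sum.inr (j, 0))) = if i = j then 1 else 0 := by
    intro i j
    rw [hcoord]
    by_cases h : i = j
    · subst h; rw [if_pos rfl, if_pos rfl]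
    · rw [if_neg h, if_neg]
      intro h'
      simp only [Sum.inr.injEq, Prod.mk.injEq] at h'
      exact h h'.1.symm
  have hbb : ∀ i j : Fin g, y.coord (Sum.inr (i, 1)) (y (Sum.inr (j, 1))) = if i = j then 1 else 0 := by
    intro i j
    rw [hcoord]
    by_cases h : i = j
    · subst h; rw [if_pos rfl, if_pos rfl]
    · rw [if_neg h, if_neg]
      intro h'
      simp only [Sum.inr.injEq, Prod.mk.injEq] at h'
      exact h h'.1.symm
  have hab : ∀ i j : Fin g, y.coord (Sum.inr (i, 0)) (y (Sum.inr (j, 1))) = 0 := by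
    intro i j
    rw [hcoord, if_neg]
    intro h'
    simp only [Sum.inr.injEq, Prod.mk.injEq] at h'
    exact absurd h'.2 (by decide)
  have hba : ∀ i j : Fin g, y.coord (Sum.inr (i, 1)) (y (Sum.inr (j, 0))) = 0 := by
    intro i j
    rw [hcoord, if_neg]
    intro h'
    simp only [Sum.inr.injEq, Prod.mk.injEq] at h'
    exact absurd h'.2 (by decide)
  -- the `2g` transvections as linear automorphisms of `K_v`
  let T : Fin g → ((closureAt v).k ≃ₗ[ℚ_[(closureAt v).residueChar]] (closureAt v).k) := fun i =>
    LinearEquiv.ofLinear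
      (LinearMap.id + (y.coord (Sum.inr (i, 1))).smulRight (y (Sum.inr (i, 0))))
      (LinearMap.id - (y.coord (Sum.inr (i, 1))).smulRight (y (Sum.inr (i, 0))))
      (by
        apply LinearMap.ext; intro x
        simp)
      (by
        apply LinearMap.ext; intro x
        simp)
  let T' : Fin g → ((closureAt v).k ≃ₗ[ℚ_[(closureAt v).residueChar]] (closureAt v).k) := fun i =>
    LinearEquiv.ofLinear
      (LinearMap.id - (y.coord (Sum.inr (i, 0))).smulRight (y (Sum.inr (i, 1))))
      (LinearMap.id + (y.coord (Sum.inr (i, 0))).smulRight (y (Sum.inr (i, 1))))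
      (by
        apply LinearMap.ext; intro x
        simp)
      (by
        apply LinearMap.ext; intro x
        simp)
  have hTapply : ∀ i x, T i x = x + y.coord (Sum.inr (i, 1)) x • y (Sum.inr (i, 0)) := fun i x => rfl
  have hT'apply : ∀ i x, T' i x = x - y.coord (Sum.inr (i, 0)) x • y (Sum.inr (i, 1)) := fun i x => rfl
  -- membership in print's (Ind1) strip part over the Galois logarithm (continuity: finite dimension over `ℚ_p`)
  have hψ : ∀ i, (T i).toAddEquiv ∈ ind1StripOf v (galoisLog v) := fun i =>
    ⟨by exact (T i).toLinearMap.continuous_of_finiteDimensional,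
      by exact (T i).symm.toLinearMap.continuous_of_finiteDimensional, φ i,
      realises_galoisLog_of_liftActsOnUnitLogAs v hpk (φ i) _ (hφ i) (T i).toAddEquiv (hTapply i)⟩
  have hψ' : ∀ i, (T' i).toAddEquiv ∈ ind1StripOf v (galoisLog v) := fun i =>
    ⟨by exact (T' i).toLinearMap.continuous_of_finiteDimensional,
      by exact (T' i).symm.toLinearMap.continuous_of_finiteDimensional, φ' i,
      realises_galoisLog_of_liftActsOnUnitLogAs v hpk (φ' i) _ (hφ' i) (T' i).toAddEquiv (hT'apply i)⟩
  -- transport of the twist data to the rescaled norm (`of` is the identity of `K_v`, `ℚ_p`-linear)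
  let e := RescaledCompletion.of F (closureAt v).residueChar v hv
  let eL : (closureAt v).k ≃ₗ[ℚ_[(closureAt v).residueChar]] RescaledCompletion F (closureAt v).residueChar v hv :=
    { e.toAddEquiv with
      map_smul' := fun c x => by
        change e (c • x) = c • e x
        rw [Algebra.smul_def, Algebra.smul_def, map_mul]
        rfl }
  have heL : ∀ x, eL x = e x := fun x => rfl
  have heLs : ∀ x, eL.symm x = e.symm x := fun x => rfl
  refine exists_mem_ind1StripOf_image_closedBall_ne_of_planes (closureAt v).residueChar v hv hf (galoisLog v) hϖ
    (ι := Fin g) hdim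
    (ca := fun i => (y.coord (Sum.inr (i, 0))).comp eL.symm.toLinearMap)
    (cb := fun i => (y.coord (Sum.inr (i, 1))).comp eL.symm.toLinearMap)
    (ya := fun i => eL (y (Sum.inr (i, 0)))) (yb := fun i => eL (y (Sum.inr (i, 1))))
    (ψ := fun i => (T i).toAddEquiv) (ψ' := fun i => (T' i).toAddEquiv) ?_ ?_ ?_ ?_ hψ hψ' ?_ ?_
  · intro i j
    change y.coord (Sum.inr (i, 0)) (eL.symm (eL (y (Sum.inr (j, 0))))) = _
    rw [LinearEquiv.symm_apply_apply, haa]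
  · intro i j
    change y.coord (Sum.inr (i, 1)) (eL.symm (eL (y (Sum.inr (j, 1))))) = _
    rw [LinearEquiv.symm_apply_apply, hbb]
  · intro i j
    change y.coord (Sum.inr (i, 0)) (eL.symm (eL (y (Sum.inr (j, 1))))) = 0
    rw [LinearEquiv.symm_apply_apply, hab]
  · intro i j
    change y.coord (Sum.inr (i, 1)) (eL.symm (eL (y (Sum.inr (j, 0))))) = 0
    rw [LinearEquiv.symm_apply_apply, hba]
  · intro i x
    change e (T i (e.symm x)) = x + y.coord (Sum.inr (i, 1)) (eL.symm x) • eL (y (Sum.inr (i, 0)))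
    rw [hTapply, map_add, RingEquiv.apply_symm_apply, ← heL, ← heLs, map_smul]
  · intro i x
    change e (T' i (e.symm x)) = x - y.coord (Sum.inr (i, 0)) (eL.symm x) • eL (y (Sum.inr (i, 1)))
    rw [hT'apply, map_sub, RingEquiv.apply_symm_apply, ← heL, ← heLs, map_smul]

/-- **The same over abc-iut-c312-5's ANALYTIC logarithm** (`Real.galoisLog_eq_analyticLogv`, w5-d216 p452975): assuming
`DehnTwistTransvectionsOnUnitsAll`, at every `v ∣ p` with `p` odd, `f(v|p)` odd, `e(v|p) ≥ 3`, some
`χ ∈ Real.ind1StripOf v (analyticLogv F v)` and `m ∈ ℤ` have `χ(B(0,‖ϖ‖^m)) ≠ B(0,‖ϖ‖^m)`.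
[claim: Mochizuki2012, status: disputed] [cite: Kondo2025OuterAutMLF, §2 Thm 2.1 and proof of Thm 2.3 p.10] -/
theorem exists_mem_ind1StripOf_analyticLogv_image_closedBall_ne_of_dehnTwistsAll_odd
    (hJW : DehnTwistTransvectionsOnUnitsAll) (p : ℕ) [Fact p.Prime] (hv : ((p : ℕ) : 𝓞 F) ∈ v.asIdeal) (hp2 : p ≠ 2)
    (hf : Odd (v.asIdeal.inertiaDeg ℤ)) (he : 3 ≤ v.asIdeal.ramificationIdx ℤ)
    {ϖ : (RescaledCompletion F p v hv)ˣ} (hϖ : IsUniformizer ϖ) :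
    ∃ χ ∈ ind1StripOf v (analyticLogv F v), ∃ m : ℤ,
      (fun x => RescaledCompletion.of F p v hv (χ ((RescaledCompletion.of F p v hv).symm x))) ''
          closedBall (0 : RescaledCompletion F p v hv) (‖(ϖ : RescaledCompletion F p v hv)‖ ^ m) ≠
        closedBall (0 : RescaledCompletion F p v hv) (‖(ϖ : RescaledCompletion F p v hv)‖ ^ m) := by
  rw [← galoisLog_eq_analyticLogv]
  exact exists_mem_ind1StripOf_galoisLog_image_closedBall_ne_of_dehnTwistsAll_odd v hJW p hv hp2 hf he hϖ

end Summit.ABC.IUTFork.Thm311.Real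

end
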